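import Summits.NavierStokesRegularity.NavierStokesRegularity.Theorems.PerpetualPumpAveragedTypeIBlowupLevelOneBondTools
import Mathlib.Topology.Order.Compact

/-!
# Crux `PerpetualPump.AveragedTypeIBlowup` (stmt-NavierStokesRegularity-1835), line `Sketch`:
# stub `levelOneBond` — the next bond during the transfer pulse

This file proves the registered stub `stub_levelOneBond` of the line skeleton
`Cruxes/AveragedTypeIBlowup/Lines/Sketch.lean`; its tools are in
`PerpetualPumpAveragedTypeIBlowupLevelOneBondTools.lean`.

In the slow time `σ ∈ [0, T]` (`T ≤ 1/10`) of the front, counted from ignition, the next bond `y`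
solves the scalar linear equation `y' = K y + f` with rate `K = q⁴(qβ − x₂/q − 1)` and forcing
`f = q⁴ ε̄q²β² + e_y`, where `β ∈ [−1/50, B_β]` is the renormalised next carrier
(`∫₀^σ|β| ≤ Λ`), `|x₂| ≤ 1/2`, and the memory error `|e_y| ≤ η q⁴ my` is controlled by a
majorant `my` given in restart (Duhamel) form. We prove

* (i) the a-priori growth bound `|y(σ)| ≤ e^{q⁵Λ}(y₀ + 3ε̄q²B_β²σ)` together with the
  bond-majorant bound `my ≤ 4ε̄ + 2((qB_β+1) e^{q⁵Λ}(y₀ + 3ε̄q²B_β²σ) + ε̄q²B_β²)`;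
* (ii) positivity after the rise: if `∫₀^{σh}|β| ≤ 1` and `β ≥ B_β/5` on
  `[σh, σh + 1/(2B_β)]`, then `y(σ) > 0` for `σ ≥ σh + 1/(2B_β)`.

Proof. By the landed comparison principle the solution is given by variation of constants,
`y = e^{Γ} z` with `Γ = ∫₀ K` and `z = y(0) + ∫₀ e^{-Γ} f` (`levelOneBond_duhamel`). Since
`K ≤ q⁵|β|`, `e^{Γ} ≤ e^{q⁵Λ}`; since `K ≥ −5/2` and `T ≤ 1/10`, `e^{Γ(s) − Γ(u)} ≤ 4/3` for
`s ≤ u`. Working with `z`, whose supremum `M` of `|z|` on `[0, T]` is attained by continuity, the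
memory feedback obeys
`e^{-Γ(u)} η q⁴ my(u) ≤ ERR = η q⁴ (16ε̄/3 + q⁴((4/3) M (qB_β+1) + (4/3) ε̄q²B_β²)/10)` and
`|z(u)| ≤ y₀ + C u` with `C = (4/3) q⁴ ε̄q²B_β² + ERR`; the self-consistent inequality
`M ≤ y₀ + C/10` and `η (qB_β+1)³ ≤ 10⁻⁶` give `ERR ≤ ε̄/10⁶`, `C ≤ 2ε̄q²B_β²`
(`levelOneBond_arith`), whence (i). For (ii), on the rise interval `Γ ≤ q⁵(1 + 1/2) ≤ 2`, so
the seed contributes at least `e^{-2} q⁶ ε̄ (B_β/5)² / (2B_β) ≥ 25 ε̄` to `z`, beating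
`y(0) ≥ -2ε̄` and the error `ERR σ ≤ ε̄/10⁷`.

## References

Folklore (variation of constants / Grönwall), used as in T. Tao, *Finite time blowup for an
averaged three-dimensional Navier–Stokes equation*, J. Amer. Math. Soc. 29 (2016), §5–6.
-/

noncomputable section

-- the summit namespace `…NavierStokesRegularity.NavierStokesRegularity…` is the tree convention
set_option linter.dupNamespace false

open MeasureTheory Set Filter Topology

namespace Summit.NavierStokesRegularity.NavierStokesRegularity.Theorems.PerpetualPumpAveragedTypeIBlowup

/-- **Registered stub `stub_levelOneBond`** (line `Sketch` of crux
`PerpetualPump.AveragedTypeIBlowup`, stmt-NavierStokesRegularity-1835). THE NEXT BOND DURING THE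
TRANSFER PULSE, slow time of the front from ignition (`T ≤ 1/10`):
`y' = q⁴(y(qβ − x₂/q − 1) + ε̄q²β²) + e_y` where `β ∈ [−1/50, B_β]` is the renormalised next
carrier with `∫₀^σ|β| ≤ Λ`, `|x₂| ≤ 1/2`, relative memory errors `η`. (i) A-priori growth
`|y(σ)| ≤ e^{q⁵Λ}(y₀ + 3ε̄q²B_β²σ)` and the bond-majorant bound; (ii) positivity after the rise:
if `∫₀^{σh}|β| ≤ 1` and `β ≥ B_β/5` on `[σh, σh + 1/(2B_β)]`, then `y > 0` from
`σh + 1/(2B_β)` on (variation of constants with integrating factor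
`e^{∫q⁴(qβ − x₂/q − 1)}`). [folklore] -/
theorem stub_levelOneBond :
    ∀ (y β x2 my ey : ℝ → ℝ) (q θ η εb Bβ Λ y0 T : ℝ),
      1 ≤ q → q ≤ 21 / 20 → 1 / 2 ≤ θ → θ ≤ 1 → 0 ≤ η → 0 < εb → 10 ^ 4 ≤ Bβ →
      εb * q ^ 2 * Bβ ^ 2 ≤ 1 → η * (q * Bβ + 1) ^ 3 ≤ 1 / 10 ^ 6 → 0 ≤ Λ → 0 ≤ y0 → y0 ≤ 2 * εb →
      0 ≤ T → T ≤ 1 / 10 →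
      ContinuousOn y (Icc 0 T) → ContinuousOn β (Icc 0 T) → ContinuousOn x2 (Icc 0 T) →
      ContinuousOn my (Icc 0 T) → ContinuousOn ey (Icc 0 T) →
      (∀ σ ∈ Ioo 0 T, HasDerivAt y
        (q ^ 4 * (y σ * (q * β σ - x2 σ / q - 1) + εb * q ^ 2 * (β σ) ^ 2) + ey σ) σ) →
      (∀ σ ∈ Icc 0 T, |ey σ| ≤ η * q ^ 4 * my σ) →
      (∀ σ ∈ Icc 0 T, 0 ≤ my σ ∧ my σ ≤ my 0 * Real.exp (-(θ * q ^ 4 * σ)) +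
        q ^ 4 * ∫ u in (0 : ℝ)..σ, Real.exp (-(θ * q ^ 4 * (σ - u))) *
          |y u * (q * β u - x2 u / q) + εb * q ^ 2 * (β u) ^ 2|) →
      (∀ σ ∈ Icc 0 T, -(1 / 50) ≤ β σ ∧ β σ ≤ Bβ) → (∀ σ ∈ Icc 0 T, ∫ u in (0 : ℝ)..σ, |β u| ≤ Λ) →
      (∀ σ ∈ Icc 0 T, |x2 σ| ≤ 1 / 2) →
      |y 0| ≤ y0 → my 0 ≤ 4 * εb →
      (∀ σ ∈ Icc 0 T, |y σ| ≤ Real.exp (q ^ 5 * Λ) * (y0 + 3 * εb * q ^ 2 * Bβ ^ 2 * σ) ∧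
        my σ ≤ 4 * εb + 2 * ((q * Bβ + 1) * Real.exp (q ^ 5 * Λ) * (y0 + 3 * εb * q ^ 2 * Bβ ^ 2 * σ) +
          εb * q ^ 2 * Bβ ^ 2)) ∧
      (∀ σh ∈ Icc 0 T, σh + 1 / (2 * Bβ) ≤ T → (∫ u in (0 : ℝ)..σh, |β u| ≤ 1) →
        (∀ u ∈ Icc σh (σh + 1 / (2 * Bβ)), Bβ / 5 ≤ β u) →
        ∀ σ ∈ Icc (σh + 1 / (2 * Bβ)) T, 0 < y σ) := by
  intro y β x2 my ey q θ η εb Bβ Λ y0 T hq1 hq2 hθ1 _hθ2 hη hεb hBβ _hE1 hηP _hΛ hy0 hy0ε hT0 hT1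
    hyc hβc hx2c _hmyc heyc hode hey hmy hβb hβΛ hx2b hy00 hmy0
  have hq0 : 0 < q := by linarith
  have hB0 : 0 < Bβ := by linarith
  have hq40 : 0 < q ^ 4 := by positivity
  have hq4 : q ^ 4 ≤ (21 / 20) ^ 4 := pow_le_pow_left₀ hq0.le hq2 4
  have hq5 : q ^ 5 ≤ (21 / 20) ^ 5 := pow_le_pow_left₀ hq0.le hq2 5
  have hq6 : (1 : ℝ) ≤ q ^ 6 := one_le_pow₀ hq1
  have hmy00 : 0 ≤ my 0 := (hmy 0 ⟨le_rfl, hT0⟩).1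
  have hθ0 : (0 : ℝ) ≤ θ := by linarith
  -- the rate `K`, the forcing `f`, the primitive `Γ`, the Duhamel bracket `z`
  obtain ⟨K, hKd⟩ : ∃ K : ℝ → ℝ, K = fun u => q ^ 4 * (q * β u - x2 u / q - 1) := ⟨_, rfl⟩
  obtain ⟨f, hfd⟩ : ∃ f : ℝ → ℝ, f = fun u => q ^ 4 * (εb * q ^ 2 * (β u) ^ 2) + ey u :=
    ⟨_, rfl⟩
  have hK : ∀ u, K u = q ^ 4 * (q * β u - x2 u / q - 1) := fun u => by rw [hKd]
  have hf : ∀ u, f u = q ^ 4 * (εb * q ^ 2 * (β u) ^ 2) + ey u := fun u => by rw [hfd]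
  have hKc : ContinuousOn K (Icc 0 T) := by
    rw [hKd]
    exact continuousOn_const.mul
      (((continuousOn_const.mul hβc).sub (hx2c.div_const q)).sub continuousOn_const)
  have hfc : ContinuousOn f (Icc 0 T) := by
    rw [hfd]
    exact (continuousOn_const.mul (continuousOn_const.mul (hβc.pow 2))).add heyc
  have hd : ∀ t ∈ Ioo 0 T, HasDerivAt y (K t * y t + f t) t := fun t ht =>
    (hode t ht).congr_deriv (by rw [hK, hf]; ring)
  obtain ⟨Γ, hΓd⟩ : ∃ Γ : ℝ → ℝ, Γ = fun u => ∫ s in (0 : ℝ)..u, K s := ⟨_, rfl⟩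
  have hΓ : ∀ u, Γ u = ∫ s in (0 : ℝ)..u, K s := fun u => by rw [hΓd]
  have hΓc : ContinuousOn Γ (Icc 0 T) := by
    rw [hΓd]
    exact (linearComparison_primitive hT0 hKc).1
  have hgc : ContinuousOn (fun s => Real.exp (-Γ s) * f s) (Icc 0 T) := hΓc.neg.rexp.mul hfc
  obtain ⟨z, hzd⟩ : ∃ z : ℝ → ℝ, z = fun u => y 0 + ∫ s in (0 : ℝ)..u, Real.exp (-Γ s) * f s :=
    ⟨_, rfl⟩
  have hz : ∀ u, z u = y 0 + ∫ s in (0 : ℝ)..u, Real.exp (-Γ s) * f s := fun u => by rw [hzd]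
  have hzc : ContinuousOn z (Icc 0 T) := by
    rw [hzd]
    exact continuousOn_const.add (linearComparison_primitive hT0 hgc).1
  -- variation of constants
  have hrep : ∀ σ ∈ Icc 0 T, y σ = Real.exp (Γ σ) * z σ := by
    intro σ hσ
    rw [levelOneBond_duhamel hT0 hKc hfc hyc hd hσ, hz]
    simp only [hΓ]
  -- bounds on the rate and on the integrating factor
  have hKb : ∀ t ∈ Icc 0 T, K t ≤ q ^ 5 * |β t| ∧ -(5 / 2) ≤ K t := fun t ht => by
    rw [hK]
    exact levelOneBond_rate_bounds hq1 hq2 (hβb t ht).1 (hx2b t ht)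
  have hβa : ∀ t ∈ Icc 0 T, |β t| ≤ Bβ := fun t ht =>
    abs_le.2 ⟨by linarith [(hβb t ht).1], (hβb t ht).2⟩
  have hΓβ : ∀ u ∈ Icc 0 T, Γ u ≤ q ^ 5 * ∫ t in (0 : ℝ)..u, |β t| := fun u hu => by
    rw [hΓ]
    exact levelOneBond_primitive_le hKc hβc (fun t ht => (hKb t ht).1) hu.1 hu.2
  have hΓΛ : ∀ u ∈ Icc 0 T, Real.exp (Γ u) ≤ Real.exp (q ^ 5 * Λ) := fun u hu =>
    Real.exp_le_exp.2 ((hΓβ u hu).trans (mul_le_mul_of_nonneg_left (hβΛ u hu) (by positivity)))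
  have hΓdiff : ∀ s u, 0 ≤ s → s ≤ u → u ≤ T → Real.exp (Γ s - Γ u) ≤ 4 / 3 :=
    fun s u hs hsu hu => by
      rw [hΓ, hΓ]
      exact levelOneBond_exp_primitive_diff_le hT1 hKc (fun t ht => (hKb t ht).2) hs hsu hu
  have hΓ0 : ∀ u ∈ Icc 0 T, Real.exp (-Γ u) ≤ 4 / 3 := fun u hu => by
    have h := hΓdiff 0 u le_rfl hu.1 hu.2
    rwa [hΓ 0, intervalIntegral.integral_same, zero_sub] at h
  -- the supremum `M` of the Duhamel bracket
  obtain ⟨sM, hsM, hMax⟩ := isCompact_Icc.exists_isMaxOn (nonempty_Icc.2 hT0) hzc.abs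
  obtain ⟨M, hMd⟩ : ∃ M : ℝ, M = |z sM| := ⟨_, rfl⟩
  have hM0 : 0 ≤ M := by
    rw [hMd]
    exact abs_nonneg _
  have hzM : ∀ s ∈ Icc 0 T, |z s| ≤ M := fun s hs => by
    rw [hMd]
    exact (isMaxOn_iff.1 hMax) s hs
  -- the back-amplified size of `y`
  have hyshift : ∀ s u, 0 ≤ s → s ≤ u → u ≤ T → Real.exp (-Γ u) * |y s| ≤ 4 / 3 * M := by
    intro s u hs hsu hu
    have hsT : s ∈ Icc 0 T := ⟨hs, hsu.trans hu⟩
    rw [hrep s hsT, abs_mul, Real.abs_exp, ← mul_assoc, ← Real.exp_add, neg_add_eq_sub]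
    exact mul_le_mul (hΓdiff s u hs hsu hu) (hzM s hsT) (abs_nonneg _) (by norm_num)
  -- the memory feedback `e^{-Γ} η q⁴ my ≤ ERR`
  obtain ⟨ERR, hERRd⟩ : ∃ ERR : ℝ, ERR = η * q ^ 4 * (4 / 3 * (4 * εb) +
      q ^ 4 * ((4 / 3 * M * (q * Bβ + 1) + 4 / 3 * (εb * q ^ 2 * Bβ ^ 2)) * (1 / 10))) :=
    ⟨_, rfl⟩
  have hERR0 : 0 ≤ ERR := by
    rw [hERRd]
    positivity
  have herr : ∀ u ∈ Icc 0 T, Real.exp (-Γ u) * (η * q ^ 4 * my u) ≤ ERR := by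
    intro u hu
    have he43 := hΓ0 u hu
    have heinv : Real.exp (-Γ u) * Real.exp (Γ u) = 1 := by
      rw [← Real.exp_add, neg_add_cancel, Real.exp_zero]
    have hY : ∀ s ∈ Icc 0 u, |y s| ≤ Real.exp (Γ u) * (4 / 3 * M) := by
      intro s hs
      have h1 := hyshift s u hs.1 hs.2 hu.2
      calc |y s| = Real.exp (Γ u) * (Real.exp (-Γ u) * |y s|) := by
            rw [← mul_assoc, mul_comm (Real.exp (Γ u)), heinv, one_mul]
        _ ≤ Real.exp (Γ u) * (4 / 3 * M) := mul_le_mul_of_nonneg_left h1 (Real.exp_pos _).le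
    have hmyb := levelOneBond_majorant_le hq1 hθ0 hεb hBβ hβb hx2b hu hY hmy00 hmy0 (hmy u hu).2
    have hE0 : 0 ≤ εb * q ^ 2 * Bβ ^ 2 := by positivity
    have a1 : Real.exp (-Γ u) * (4 * εb) ≤ 4 / 3 * (4 * εb) :=
      mul_le_mul_of_nonneg_right he43 (by positivity)
    have a0 : Real.exp (-Γ u) * (εb * q ^ 2 * Bβ ^ 2) ≤ 4 / 3 * (εb * q ^ 2 * Bβ ^ 2) :=
      mul_le_mul_of_nonneg_right he43 hE0
    have a2 : (4 / 3 * M * (q * Bβ + 1) + Real.exp (-Γ u) * (εb * q ^ 2 * Bβ ^ 2)) * u ≤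
        (4 / 3 * M * (q * Bβ + 1) + 4 / 3 * (εb * q ^ 2 * Bβ ^ 2)) * (1 / 10) :=
      mul_le_mul (add_le_add_right a0 _) (hu.2.trans hT1) hu.1 (by positivity)
    calc Real.exp (-Γ u) * (η * q ^ 4 * my u)
        ≤ Real.exp (-Γ u) * (η * q ^ 4 * (4 * εb + q ^ 4 *
            ((Real.exp (Γ u) * (4 / 3 * M) * (q * Bβ + 1) + εb * q ^ 2 * Bβ ^ 2) * u))) :=
          mul_le_mul_of_nonneg_left (mul_le_mul_of_nonneg_left hmyb (by positivity))
            (Real.exp_pos _).le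
      _ = η * q ^ 4 * (Real.exp (-Γ u) * (4 * εb) + q ^ 4 *
            ((4 / 3 * M * (q * Bβ + 1) * (Real.exp (-Γ u) * Real.exp (Γ u)) +
              Real.exp (-Γ u) * (εb * q ^ 2 * Bβ ^ 2)) * u)) := by ring
      _ = η * q ^ 4 * (Real.exp (-Γ u) * (4 * εb) + q ^ 4 *
            ((4 / 3 * M * (q * Bβ + 1) + Real.exp (-Γ u) * (εb * q ^ 2 * Bβ ^ 2)) * u)) := by
          rw [heinv, mul_one]
      _ ≤ ERR := by
          rw [hERRd]
          exact mul_le_mul_of_nonneg_left (add_le_add a1 (mul_le_mul_of_nonneg_left a2 hq40.le))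
            (by positivity)
  -- the total forcing rate `C` of the bracket
  obtain ⟨C, hCd⟩ : ∃ C : ℝ, C = 4 / 3 * (q ^ 4 * (εb * q ^ 2 * Bβ ^ 2)) + ERR := ⟨_, rfl⟩
  have hC0 : 0 ≤ C := by
    rw [hCd]
    positivity
  have hC : ∀ s ∈ Icc 0 T, |Real.exp (-Γ s) * f s| ≤ C := by
    intro s hs
    rw [abs_mul, Real.abs_exp, hf]
    have hb2 : (β s) ^ 2 ≤ Bβ ^ 2 := sq_le_sq' (by linarith [(hβb s hs).1]) (hβb s hs).2
    have h1 : |q ^ 4 * (εb * q ^ 2 * (β s) ^ 2) + ey s| ≤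
        q ^ 4 * (εb * q ^ 2 * Bβ ^ 2) + η * q ^ 4 * my s := by
      calc _ ≤ |q ^ 4 * (εb * q ^ 2 * (β s) ^ 2)| + |ey s| := abs_add_le _ _
        _ ≤ _ := by
          rw [abs_of_nonneg (by positivity : (0 : ℝ) ≤ q ^ 4 * (εb * q ^ 2 * (β s) ^ 2))]
          exact add_le_add (by gcongr) (hey s hs)
    calc Real.exp (-Γ s) * |q ^ 4 * (εb * q ^ 2 * (β s) ^ 2) + ey s|
        ≤ Real.exp (-Γ s) * (q ^ 4 * (εb * q ^ 2 * Bβ ^ 2) + η * q ^ 4 * my s) :=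
          mul_le_mul_of_nonneg_left h1 (Real.exp_pos _).le
      _ = Real.exp (-Γ s) * (q ^ 4 * (εb * q ^ 2 * Bβ ^ 2)) +
            Real.exp (-Γ s) * (η * q ^ 4 * my s) := mul_add _ _ _
      _ ≤ C := by
          rw [hCd]
          exact add_le_add (mul_le_mul_of_nonneg_right (hΓ0 s hs) (by positivity)) (herr s hs)
  -- the bracket grows at most linearly
  have hzb : ∀ u ∈ Icc 0 T, |z u| ≤ y0 + C * u := by
    intro u hu
    rw [hz]
    have h := intervalIntegral.norm_integral_le_of_norm_le_const (a := (0 : ℝ)) (b := u) (C := C)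
      (f := fun s => Real.exp (-Γ s) * f s) fun s hs => by
        rw [uIoc_of_le hu.1] at hs
        rw [Real.norm_eq_abs]
        exact hC s ⟨hs.1.le, hs.2.trans hu.2⟩
    rw [Real.norm_eq_abs, sub_zero, abs_of_nonneg hu.1] at h
    exact (abs_add_le _ _).trans (add_le_add hy00 h)
  -- closing the bookkeeping
  have hMb : M ≤ y0 + C * (1 / 10) := by
    have h1 := hzM sM hsM
    have h2 := hzb sM hsM
    have h3 : C * sM ≤ C * (1 / 10) := mul_le_mul_of_nonneg_left (hsM.2.trans hT1) hC0
    have h4 : |z sM| = M := hMd.symm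
    linarith
  rw [hCd, hERRd] at hMb
  obtain ⟨hERR, hC2⟩ := levelOneBond_arith hq1 hq2 hη hεb hBβ hηP hy0 hy0ε hM0 hMb
  rw [← hERRd] at hERR hC2
  rw [← hCd] at hC2
  -- (i) the a-priori bound on `y`
  have hya : ∀ σ ∈ Icc 0 T,
      |y σ| ≤ Real.exp (q ^ 5 * Λ) * (y0 + 3 * εb * q ^ 2 * Bβ ^ 2 * σ) := by
    intro σ hσ
    have hσ0 : (0 : ℝ) ≤ σ := hσ.1
    rw [hrep σ hσ, abs_mul, Real.abs_exp]
    have h1 : |z σ| ≤ y0 + 3 * εb * q ^ 2 * Bβ ^ 2 * σ := by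
      have h2 := hzb σ hσ
      have h3 : C * σ ≤ 2 * (εb * q ^ 2 * Bβ ^ 2) * σ := mul_le_mul_of_nonneg_right hC2 hσ.1
      have h4 : 0 ≤ εb * q ^ 2 * Bβ ^ 2 * σ := by positivity
      linarith
    exact mul_le_mul (hΓΛ σ hσ) h1 (abs_nonneg _) (Real.exp_pos _).le
  refine ⟨fun σ hσ => ⟨hya σ hσ, ?_⟩, ?_⟩
  · -- (i') the bond majorant
    have hσ0 : (0 : ℝ) ≤ σ := hσ.1
    obtain ⟨Eσ, hEσ⟩ :
        ∃ Eσ : ℝ, Eσ = Real.exp (q ^ 5 * Λ) * (y0 + 3 * εb * q ^ 2 * Bβ ^ 2 * σ) := ⟨_, rfl⟩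
    have hEσ0 : 0 ≤ Eσ := by
      rw [hEσ]
      positivity
    have hY : ∀ u ∈ Icc 0 σ, |y u| ≤ Eσ := by
      intro u hu
      rw [hEσ]
      refine (hya u ⟨hu.1, hu.2.trans hσ.2⟩).trans
        (mul_le_mul_of_nonneg_left ?_ (Real.exp_pos _).le)
      have : 3 * εb * q ^ 2 * Bβ ^ 2 * u ≤ 3 * εb * q ^ 2 * Bβ ^ 2 * σ :=
        mul_le_mul_of_nonneg_left hu.2 (by positivity)
      linarith
    have hmyb := levelOneBond_majorant_le hq1 hθ0 hεb hBβ hβb hx2b hσ hY hmy00 hmy0 (hmy σ hσ).2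
    have h3 : q ^ 4 * ((Eσ * (q * Bβ + 1) + εb * q ^ 2 * Bβ ^ 2) * σ) ≤
        2 * ((q * Bβ + 1) * Eσ + εb * q ^ 2 * Bβ ^ 2) := by
      have hpos : 0 ≤ Eσ * (q * Bβ + 1) + εb * q ^ 2 * Bβ ^ 2 := by positivity
      have hq4σ : q ^ 4 * σ ≤ (21 / 20) ^ 4 * (1 / 10) :=
        mul_le_mul hq4 (hσ.2.trans hT1) hσ.1 (by positivity)
      have h5 : q ^ 4 * σ * (Eσ * (q * Bβ + 1) + εb * q ^ 2 * Bβ ^ 2) ≤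
          (21 / 20) ^ 4 * (1 / 10) * (Eσ * (q * Bβ + 1) + εb * q ^ 2 * Bβ ^ 2) :=
        mul_le_mul_of_nonneg_right hq4σ hpos
      linarith
    have h4 : (q * Bβ + 1) * Eσ = (q * Bβ + 1) * Real.exp (q ^ 5 * Λ) *
        (y0 + 3 * εb * q ^ 2 * Bβ ^ 2 * σ) := by
      rw [hEσ]
      ring
    rw [← h4]
    linarith
  · -- (ii) positivity after the rise
    intro σh hσh hhT hβ1 hrise σ hσ
    have hh0 : 0 < 1 / (2 * Bβ) := by positivity
    have hb0 : 0 ≤ σh + 1 / (2 * Bβ) := by linarith [hσh.1]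
    have hσT : σ ∈ Icc 0 T := ⟨hb0.trans hσ.1, hσ.2⟩
    rw [hrep σ hσT]
    refine mul_pos (Real.exp_pos _) ?_
    rw [hz]
    -- lower bounds on the integrand `e^{-Γ} f`
    have hglow : ∀ s ∈ Icc 0 T, -ERR ≤ Real.exp (-Γ s) * f s := by
      intro s hs
      rw [hf, mul_add]
      have h1 : 0 ≤ Real.exp (-Γ s) * (q ^ 4 * (εb * q ^ 2 * (β s) ^ 2)) := by positivity
      have h2 : -(Real.exp (-Γ s) * (η * q ^ 4 * my s)) ≤ Real.exp (-Γ s) * ey s := by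
        rw [← mul_neg]
        exact mul_le_mul_of_nonneg_left (neg_le_of_abs_le (hey s hs)) (Real.exp_pos _).le
      linarith [herr s hs]
    have hgrise : ∀ s ∈ Icc σh (σh + 1 / (2 * Bβ)),
        q ^ 6 * εb * Bβ ^ 2 / 200 - ERR ≤ Real.exp (-Γ s) * f s := by
      intro s hs
      have hsT : s ∈ Icc 0 T := ⟨hσh.1.trans hs.1, hs.2.trans hhT⟩
      -- on the rise interval `Γ ≤ q⁵ (1 + 1/2) ≤ 2`
      have hΓs : Γ s ≤ 2 := by
        have hi1 : IntervalIntegrable (fun t => |β t|) volume 0 σh :=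
          (hβc.mono (Icc_subset_Icc_right hσh.2)).abs.intervalIntegrable_of_Icc hσh.1
        have hi2 : IntervalIntegrable (fun t => |β t|) volume σh s :=
          (hβc.mono (Icc_subset_Icc hσh.1 hsT.2)).abs.intervalIntegrable_of_Icc hs.1
        have hsplit := intervalIntegral.integral_add_adjacent_intervals hi1 hi2
        have hpiece : ‖∫ t in σh..s, |β t|‖ ≤ Bβ * |s - σh| :=
          intervalIntegral.norm_integral_le_of_norm_le_const fun t ht => by
            rw [uIoc_of_le hs.1] at ht
            rw [Real.norm_eq_abs, abs_abs]
            exact hβa t ⟨hσh.1.trans ht.1.le, ht.2.trans hsT.2⟩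
        rw [Real.norm_eq_abs, abs_of_nonneg (by linarith [hs.1] : (0 : ℝ) ≤ s - σh)] at hpiece
        have hp2 : ∫ t in σh..s, |β t| ≤ Bβ * (1 / (2 * Bβ)) :=
          ((le_abs_self _).trans hpiece).trans
            (mul_le_mul_of_nonneg_left (by linarith [hs.2]) hB0.le)
        have hBB : Bβ * (1 / (2 * Bβ)) = 1 / 2 := by
          field_simp
        have h3 := hΓβ s hsT
        rw [← hsplit] at h3
        have hq50 : (0 : ℝ) ≤ q ^ 5 := by positivity
        have hX : q ^ 5 * (∫ t in (0 : ℝ)..σh, |β t|) ≤ q ^ 5 * 1 :=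
          mul_le_mul_of_nonneg_left hβ1 hq50
        have hY : q ^ 5 * (∫ t in σh..s, |β t|) ≤ q ^ 5 * (1 / 2) :=
          mul_le_mul_of_nonneg_left (hp2.trans hBB.le) hq50
        linarith
      have heΓ : 1 / 8 ≤ Real.exp (-Γ s) :=
        levelOneBond_exp_neg_two_ge.trans (Real.exp_le_exp.2 (by linarith))
      have hβs : Bβ / 5 ≤ β s := hrise s hs
      have hβ2 : (Bβ / 5) ^ 2 ≤ (β s) ^ 2 := pow_le_pow_left₀ (by positivity) hβs 2
      rw [hf, mul_add]
      have h2 : -(Real.exp (-Γ s) * (η * q ^ 4 * my s)) ≤ Real.exp (-Γ s) * ey s := by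
        rw [← mul_neg]
        exact mul_le_mul_of_nonneg_left (neg_le_of_abs_le (hey s hsT)) (Real.exp_pos _).le
      have h1 : q ^ 6 * εb * Bβ ^ 2 / 200 ≤
          Real.exp (-Γ s) * (q ^ 4 * (εb * q ^ 2 * (β s) ^ 2)) := by
        calc q ^ 6 * εb * Bβ ^ 2 / 200 = 1 / 8 * (q ^ 4 * (εb * q ^ 2 * (Bβ / 5) ^ 2)) := by ring
          _ ≤ Real.exp (-Γ s) * (q ^ 4 * (εb * q ^ 2 * (β s) ^ 2)) :=
            mul_le_mul heΓ (by gcongr) (by positivity) (Real.exp_pos _).le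
      linarith [herr s hsT]
    -- splitting `∫₀^σ = ∫₀^{σh} + ∫_{σh}^{σh + 1/(2B_β)} + ∫_{σh + 1/(2B_β)}^σ`
    have hgi : ∀ a c, 0 ≤ a → a ≤ c → c ≤ T →
        IntervalIntegrable (fun s => Real.exp (-Γ s) * f s) volume a c := fun a c ha hac hc =>
      (hgc.mono (Icc_subset_Icc ha hc)).intervalIntegrable_of_Icc hac
    have hI1 : -ERR * (σh - 0) ≤ ∫ s in (0 : ℝ)..σh, Real.exp (-Γ s) * f s :=
      levelOneBond_const_mul_le_integral hσh.1 (hgc.mono (Icc_subset_Icc_right hσh.2))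
        fun s hs => hglow s ⟨hs.1, hs.2.trans hσh.2⟩
    have hI2 : (q ^ 6 * εb * Bβ ^ 2 / 200 - ERR) * (σh + 1 / (2 * Bβ) - σh) ≤
        ∫ s in σh..(σh + 1 / (2 * Bβ)), Real.exp (-Γ s) * f s :=
      levelOneBond_const_mul_le_integral (by linarith) (hgc.mono (Icc_subset_Icc hσh.1 hhT))
        hgrise
    have hI3 : -ERR * (σ - (σh + 1 / (2 * Bβ))) ≤
        ∫ s in (σh + 1 / (2 * Bβ))..σ, Real.exp (-Γ s) * f s :=
      levelOneBond_const_mul_le_integral hσ.1 (hgc.mono (Icc_subset_Icc hb0 hσ.2))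
        fun s hs => hglow s ⟨hb0.trans hs.1, hs.2.trans hσ.2⟩
    have hsplit : ∫ s in (0 : ℝ)..σ, Real.exp (-Γ s) * f s =
        (∫ s in (0 : ℝ)..σh, Real.exp (-Γ s) * f s) +
        (∫ s in σh..(σh + 1 / (2 * Bβ)), Real.exp (-Γ s) * f s) +
        ∫ s in (σh + 1 / (2 * Bβ))..σ, Real.exp (-Γ s) * f s := by
      rw [intervalIntegral.integral_add_adjacent_intervals (hgi _ _ le_rfl hσh.1 hσh.2)
          (hgi _ _ hσh.1 (by linarith) hhT),
        intervalIntegral.integral_add_adjacent_intervals (hgi _ _ le_rfl hb0 hhT)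
          (hgi _ _ hb0 hσ.1 hσ.2)]
    rw [hsplit]
    -- arithmetic: `y(0) ≥ -2ε̄`, error `≤ ε̄/10⁷`, seed `≥ q⁶ ε̄ B_β / 400 ≥ 25 ε̄`
    have hy0' : -y0 ≤ y 0 := neg_le_of_abs_le hy00
    have hseed : q ^ 6 * εb * Bβ ^ 2 / 200 * (σh + 1 / (2 * Bβ) - σh) =
        q ^ 6 * εb * Bβ / 400 := by
      field_simp
      ring
    have hseed2 : 25 * εb ≤ q ^ 6 * εb * Bβ / 400 := by
      have h : (1 : ℝ) * 10 ^ 4 ≤ q ^ 6 * Bβ := mul_le_mul hq6 hBβ (by norm_num) (by positivity)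
      have h2 : (1 : ℝ) * 10 ^ 4 * εb ≤ q ^ 6 * Bβ * εb := mul_le_mul_of_nonneg_right h hεb.le
      linarith only [h2]
    have hEσ : ERR * σ ≤ εb / 10 ^ 6 * (1 / 10) :=
      mul_le_mul hERR (hσ.2.trans hT1) hσT.1 (by positivity)
    linarith only [hI1, hI2, hI3, hy0', hy0ε, hεb, hseed, hseed2, hEσ]

end Summit.NavierStokesRegularity.NavierStokesRegularity.Theorems.PerpetualPumpAveragedTypeIBlowup

end
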